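import Literature.NumberTheory.LFunctions.AlternativeHypothesisConsequences
import HarnessLib

/-!
# The second moment of pairs of zeta zeros in windows of the mean spacing (Gallagher–Mueller, Fujii, Tsang; GLSS 2026 §3)

LABEL (cell `rh-crit`, corpus C5 `ah`): **NOT RH-BEARING.** RH-FREE corpus literature: an
unconditional second-moment asymptotic for the ordinates of the zeros of `ζ`, typed as a NAMED FACT
(D-0014) with its printed constants; consumed by `AlternativeHypothesisConsequencesProofs.lean` to
prove GLSS 2026 Theorem 2 (`glss2026_theorem2_of_dsec2`). bears_on: LADDER-RH §4 HELD «conditional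
bridges: exceptional zero ⇒ …» (rh-crit/ah GAP-LEDGER row G-ah-10). WHAT THIS IS NOT: a claim about
RH, pair correlation or AH; nothing here bears on the truth of RH.

## Source (held text, locators opened 2026-08-26)

[GoldstonLeeSchettlerSuriajaya2026] D. A. Goldston, J. Lee, J. Schettler, A. I. Suriajaya, *Pair
correlation conjecture for the zeros of the Riemann zeta-function II: The Alternative Hypothesis*,
J. Number Theory (2026), doi:10.1016/j.jnt.2026.05.010, arXiv:2507.06823 (held
`paper:arxiv-2507.06823`, chunk p0007 = §3 "The Method of Gallagher and Mueller"). With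
`L = (1/2π) log T` and, for `λ > 0`, (3.1)
`𝒮(T, λ) := Σ_{ρ,ρ' : 0<γ,γ'≤T, |(γ−γ')L| ≤ λ} (λ/L − |γ − γ'|)` (pairs of zeros counted with
multiplicity), GLSS state **Proposition 1** (Gallagher–Mueller [GaMu78]):
`∫_0^T (N(t + λ/L) − N(t))² dt = 𝒮(T, λ) + O(L²)`, and **Proposition 2** (Gallagher–Mueller
[GaMu78], Fujii [Fu74, Fu81], Tsang [Tsang84]):
`∫_0^T (N(t + λ/L) − N(t))² dt = λ²T + O(λ²T/L) + ∫_0^T (S(t + λ/L) − S(t))² dt + O(L²)` and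
`∫_0^T (S(t + λ/L) − S(t))² dt = (T/π²) log(2 + λ) + O(T √(log(2 + λ)))` ("Both propositions come
from [GLSS1], and the proofs are given in Section 4 of [GLSS1]"; "Throughout this paper we do not
assume RH"), and combine them into display **(3.2)** ("(Dsec2)"): "for any `λ > 0`, as `T → ∞`,
`𝒮(T, λ) − λ²T = (T/π²) log(2 + λ) + O(T √(log(2 + λ))) + O(λ²T/L)`."
Relation to the tree (dedup record, rh-crit/ah R-g5-33): `SelbergFujiiMoments.lean` /
`SelbergFujiiLargeGaps.lean` carry Fujii's moment estimates in Titchmarsh's shapes (9.25.2)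
`∫_0^T |S(t+h) − S(t)|² dt = π⁻²T log(3 + h log T) + O(T (log(3 + h log T))^{1/2})` and (9.25.3)₂
only as BINDER HYPOTHESES of their theorems (no named fact of that content exists in the tree);
(3.2) is the finer statement for the PAIR SUM `𝒮(T, λ)` (window `h = λ/L`, second main term
`(T/π²) log(2+λ)`, `√log` error), i.e. Proposition 1 (Gallagher–Mueller's bridge from the second
moment of `N(t + λ/L) − N(t)` to `𝒮`) + Proposition 2 (the (9.25.2)-type asymptotic and the
main-term computation) — the discharge road for a successor: Dsec2 ⇐ (9.25.2) (Tsang/Fujii) + GM78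
Proposition 1 + the Riemann–von Mangoldt main term. Not a duplicate.

Typed here: `GLSS2026.secondMomentSum T λ = 𝒮(T, λ)` over the tree's enumeration of the zeros
(`zeroIndexSet`, `zetaOrdinate`, as every pair count of the corpus) and the named fact
`glss2026_dsec2` = (3.2) with an ABSOLUTE implied constant and a `λ`-dependent threshold in `T`
(the reading used in the proof of GLSS Theorem 2, §4, where `λ = M` is fixed as `T → ∞` and the
constant in `O(√log M)` is absolute).

## References

* [GoldstonLeeSchettlerSuriajaya2026] §3, Propositions 1–2 and display (3.2).
* P. X. Gallagher, J. H. Mueller, *Primes and zeros in short intervals*, J. reine angew. Math. 303/304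
  (1978) 205–220 [GaMu78]; A. Fujii, *On the zeros of Dirichlet L-functions I*, Trans. AMS 196 (1974)
  [Fu74]; K.-M. Tsang, *Some Ω-theorems for the Riemann zeta-function*, Acta Arith. 46 (1986) /
  thesis (1984) [Tsang84] — the origin of Propositions 1–2 as attributed by GLSS.
-/

noncomputable section

open Filter Real
open scoped Topology

namespace Literature.NumberTheory.LFunctions

namespace GLSS2026

open scoped Classical in
/-- **`𝒮(T, λ)`** of GLSS 2026, §3 (3.1): `Σ_{ρ,ρ' : 0<γ,γ'≤T, |(γ−γ')L| ≤ λ} (λ/L − |γ − γ'|)`,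
pairs of zeros counted with multiplicity (pairs of indices in `zeroIndexSet T`), `L = (1/2π) log T`
(`GLSS2026.L`). "Closely related to the second moment for zeros in short intervals."
[cite: GoldstonLeeSchettlerSuriajaya2026, §3 eq. (3.1)] -/
def secondMomentSum (T lam : ℝ) : ℝ :=
  ∑ p ∈ (zeroIndexSet T ×ˢ zeroIndexSet T).filter
      (fun p ↦ |(zetaOrdinate p.1 - zetaOrdinate p.2) * L T| ≤ lam),
    (lam / L T - |zetaOrdinate p.1 - zetaOrdinate p.2|)

open scoped Classical in
/-- `𝒮(T, λ)` unfolded. [cite: GoldstonLeeSchettlerSuriajaya2026, §3 eq. (3.1)] -/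
theorem secondMomentSum_def (T lam : ℝ) :
    secondMomentSum T lam =
      ∑ p ∈ (zeroIndexSet T ×ˢ zeroIndexSet T).filter
          (fun p ↦ |(zetaOrdinate p.1 - zetaOrdinate p.2) * L T| ≤ lam),
        (lam / L T - |zetaOrdinate p.1 - zetaOrdinate p.2|) :=
  rfl

open scoped Classical in
/-- Every term of `𝒮(T, λ)` is non-negative for `T > 1`: on the window `|(γ − γ')L| ≤ λ` one has
`|γ − γ'| ≤ λ/L`. [cite: GoldstonLeeSchettlerSuriajaya2026, §3 eq. (3.1)] -/
theorem secondMomentSum_nonneg {T : ℝ} (hT : 1 < T) (lam : ℝ) : 0 ≤ secondMomentSum T lam := by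
  unfold secondMomentSum
  refine Finset.sum_nonneg fun p hp ↦ ?_
  have hL : 0 < L T := L_pos hT
  have h := (Finset.mem_filter.mp hp).2
  rw [abs_mul, abs_of_pos hL] at h
  rw [sub_nonneg, le_div_iff₀ hL]
  exact h

end GLSS2026

/-- **GLSS 2026, display (3.2) "(Dsec2)"** — the RH-free second moment of pairs of zeros (from
Proposition 1 = Gallagher–Mueller 1978 and Proposition 2 = Gallagher–Mueller / Fujii 1974, 1981 /
Tsang 1984; proofs in [GLSS1] §4): "for any `λ > 0`, we have, as `T → ∞`,
`𝒮(T, λ) − λ²T = (T/π²) log(2 + λ) + O(T √(log(2 + λ))) + O(λ²T/L)`", the implied constants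
absolute (the `λ`-dependence being displayed), the threshold in `T` depending on `λ`. Rendered:
there is `A₀` such that for every `λ > 0`, for all large `T`,
`|𝒮(T, λ) − λ²T − (T/π²) log(2 + λ)| ≤ A₀ (T √(log(2 + λ)) + λ²T/L)`. A NAMED FACT (unconditional,
refereed; rh-crit/ah GAP-LEDGER G-ah-10), not proved here.
[cite: GoldstonLeeSchettlerSuriajaya2026, §3 eq. (3.2)] -/
def glss2026_dsec2 : Prop :=
  ∃ A₀ : ℝ, ∀ lam : ℝ, 0 < lam → ∀ᶠ T : ℝ in atTop,
    |GLSS2026.secondMomentSum T lam - lam ^ 2 * T - T / π ^ 2 * Real.log (2 + lam)| ≤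
      A₀ * (T * Real.sqrt (Real.log (2 + lam)) + lam ^ 2 * T / GLSS2026.L T)

end Literature.NumberTheory.LFunctions

end
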